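import Mathlib
import Literature.NumberTheory.MahlerMeasure.IntegerMahlerMeasure
import Literature.NumberTheory.MahlerMeasure.MinimalMeasuresByDegree
import Literature.NumberTheory.MahlerMeasure.SmythNonreciprocalTheorem
import Literature.NumberTheory.MahlerMeasure.CyclotomicIntegerHeightBound
import HarnessLib

/-!
# Lehmer's polynomial is irreducible and Lehmer's number `1.17628…` is a Salem number of degree 10 (Lehmer 1933; McKee–Smyth §1.1, §5.2) — re-homed proofs

**Lehmer's polynomial `L(z) = z¹⁰ + z⁹ − z⁷ − z⁶ − z⁵ − z⁴ − z³ + z + 1` is irreducible, and Lehmer's number `M(L) = 1.17628…` is a Salem number of degree 10** (Lehmer 1933; McKee–Smyth, *Around the Unit Circle*, §1.1 p.22, §5.2 p.83, glossary p.38) — RE-HOMED into `Literature/` by the Hodge foundations lane (`lit-hodgefound`, seat p20, generation 36) from the venture cell `pub-namedobj` (seat `pub-namedobj-mahler`): verbatim DECLARATION-LEVEL ports, in dependency order and each with its original module docstring, of `Summits/Ventures/DiscreteObjects/Mahler/{ReciprocalFactorisation (3 declarations), ReciprocalFamilies (4), LehmerTraceIrreducible (all 5), LehmerIrreducible (all 5),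 LehmerSalem (all 4), LehmerNumber (1)}.lean`, namespace `Summit.Ventures.DiscreteObjects.Mahler` re-rooted as `Literature.NumberTheory.MahlerMeasure` (this file's path namespace).  Theorems only unless said otherwise; imports Mathlib/Literature only; every declaration carries the citation of the printed statement it formalises; declarations the cone shares with earlier ports (`IntegerMahlerMeasure`, `SmythNonreciprocalTheorem`, `SmythIsolation`, `SmallMeasureStructure`, `CyclotomicIntegerHeightBound`, `DobrowolskiTheorem`, `PerronAlgebraicInteger`) are imported, never restated; the cell's `lehmerPoly` is the tree's `lehmerPolynomial` (`MinimalMeasuresByDegree.lean`, identical body) and is NOT re-declared.  The Summits originals stay in place (transitional duplication).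

PROOF AS FORMALISED (Part headers carry the details): the trace polynomial `Q(y) = y⁵+y⁴−5y³−5y²+4y+3` (`L = x⁵ Q(x + 1/x)`) is irreducible mod 2, so a monic factor of `L` is self-reciprocal of even degree and corresponds to a factor of `Q` — none; over `ℂ`, `L = ∏ (x² − yᵢx + 1)` over the five real roots of `Q`, four in `(−2, 2)` (roots on the unit circle) and one `> 2` (roots `τ, τ⁻¹`), so `M(L) = τ` is a Salem number.
-/

noncomputable section

/-!
## Part 1 — port of `Summits/Ventures/DiscreteObjects/Mahler/ReciprocalFactorisation.lean` (3 declarations kept)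

# Palindromic (reciprocal) polynomials factor into reciprocal quadratics over `ℂ`

Cell `pub-namedobj`, seat `pub-namedobj-mahler-g2`, target (L). Framing: lottery ticket; floor = certified
bounds/negative ranges.

This closes the gap named in `ReciprocalCoeffBound.lean` / `PowerSumBound.lean`: the objects enumerated by the
census engines (monic integer polynomials of even degree `2d` with PALINDROMIC coefficients `a_j = a_{2d-j}`, the
"rec" family) have, over `ℂ`, the factorised shape `∏_{t ∈ s} (x² - t x + 1)` with `|s| = d` assumed by the
soundness theorems for the pruning tests T1/T2.

* `trace_poly_exists`: for a palindromic `P` of degree `≤ 2d` over a field there is `Q` of degree `≤ d` with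
  `P(x) = x^d · Q(x + x⁻¹)` for all `x ≠ 0` (root-free induction on `d`, peeling `a_{2d}(x^{2d} + 1)` with the
  Dickson polynomials `D_n(x + x⁻¹) = xⁿ + x⁻ⁿ` of Mathlib);
* `palindromic_factorisation`: a monic palindromic `P ∈ ℂ[x]` of degree `2d` equals
  `∏_{t ∈ Q.roots} (x² - t x + 1)`;
* `int_palindromic_factorisation`: the same for `P ∈ ℤ[x]` mapped to `ℂ`;
* `exists_halfRoot`: `x² - t x + 1 = (x - α)(x - α⁻¹)` for some `α ≠ 0`, and
  `palindromic_halfRoots_factorisation`: `P = ∏_{α ∈ s'} (x - α)(x - α⁻¹)` (the shape used in `PowerSumBound`).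
-/

section Part1

namespace Literature.NumberTheory.MahlerMeasure

open _root_.Polynomial

/-! ## Dickson polynomials `D_n = dickson 1 1 n`: degree and leading coefficient -/

/-- `natDegree (D_n) ≤ n`.
[cite: MckeeSmyth2021, §A.1 (self-reciprocal polynomials and the trace polynomial x^d P(x + 1/x))] -/
theorem dickson_one_one_natDegree_le {K : Type*} [CommRing K] [Nontrivial K] :
    ∀ n : ℕ, (dickson 1 (1 : K) n).natDegree ≤ n
  | 0 => by
      rw [dickson_zero]
      norm_num
  | 1 => by rw [dickson_one]; exact natDegree_X_le
  | (n + 2) => by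
      rw [dickson_add_two, map_one, one_mul]
      have h1 : (X * dickson 1 (1 : K) (n + 1)).natDegree ≤ n + 2 := by
        refine le_trans natDegree_mul_le ?_
        calc X.natDegree + (dickson 1 (1 : K) (n + 1)).natDegree ≤ 1 + (n + 1) :=
              add_le_add natDegree_X_le (dickson_one_one_natDegree_le (n + 1))
          _ = n + 2 := by ring
      have h2 : (dickson 1 (1 : K) n).natDegree ≤ n + 2 :=
        (dickson_one_one_natDegree_le n).trans (by omega)
      exact (natDegree_sub_le_of_le h1 h2).trans (max_self _).le

/-- The coefficient of `x^n` in `D_n` is `1` for `n ≥ 1`.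
[cite: MckeeSmyth2021, §A.1 (self-reciprocal polynomials and the trace polynomial x^d P(x + 1/x))] -/
theorem dickson_one_one_coeff_self {K : Type*} [CommRing K] [Nontrivial K] :
    ∀ n : ℕ, (dickson 1 (1 : K) (n + 1)).coeff (n + 1) = 1
  | 0 => by rw [dickson_one]; simp
  | (n + 1) => by
      rw [dickson_add_two, map_one, one_mul, coeff_sub, coeff_X_mul, dickson_one_one_coeff_self n,
        coeff_eq_zero_of_natDegree_lt (lt_of_le_of_lt (dickson_one_one_natDegree_le n) (by omega))]
      ring

/-! ## The trace polynomial -/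

/-- **Trace polynomial.** A palindromic polynomial `P` (`a_j = a_{2d-j}`, degree `≤ 2d`) over a field satisfies
`P(x) = x^d Q(x + x⁻¹)` (`x ≠ 0`) for some `Q` of degree `≤ d` whose `x^d`-coefficient is `a_{2d}`.
[cite: MckeeSmyth2021, §A.1 (self-reciprocal polynomials and the trace polynomial x^d P(x + 1/x))] -/
theorem trace_poly_exists {K : Type*} [Field K] : ∀ (d : ℕ) (P : K[X]), P.natDegree ≤ 2 * d →
    (∀ j ≤ 2 * d, P.coeff j = P.coeff (2 * d - j)) →
    ∃ Q : K[X], Q.natDegree ≤ d ∧ Q.coeff d = P.coeff (2 * d) ∧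
      ∀ x : K, x ≠ 0 → P.eval x = x ^ d * Q.eval (x + x⁻¹)
  | 0, P, hdeg, _ => by
      refine ⟨C (P.coeff 0), by simp, by simp, fun x _ => ?_⟩
      rw [eq_C_of_natDegree_le_zero hdeg]
      simp
  | (d + 1), P, hdeg, hpal => by
      set c := P.coeff (2 * (d + 1)) with hc
      set q : K[X] := P - C c * (X ^ (2 * (d + 1)) + 1) with hq
      set P'' := divX q with hP''
      have hcq : ∀ j, q.coeff j = P.coeff j - c * ((if j = 2 * (d + 1) then 1 else 0) + (if j = 0 then 1 else 0)) := by
        intro j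
        rw [hq, coeff_sub, coeff_C_mul, coeff_add, coeff_X_pow, coeff_one]
      have hc0 : P.coeff 0 = c := by
        rw [hc]; have := hpal 0 (by omega); simpa using this
      have hP''coeff : ∀ j, P''.coeff j = q.coeff (j + 1) := fun j => by rw [hP'', coeff_divX]
      -- degree of P''
      have hdeg'' : P''.natDegree ≤ 2 * d := by
        rw [natDegree_le_iff_coeff_eq_zero]
        intro j hj
        rw [hP''coeff, hcq]
        by_cases h1 : j + 1 = 2 * (d + 1)
        · rw [if_pos h1, if_neg (by omega), h1, ← hc]; ring
        · rw [if_neg h1, if_neg (by omega)]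
          have : P.coeff (j + 1) = 0 := by
            apply coeff_eq_zero_of_natDegree_lt
            have : (2 * d : ℕ) < j := by exact_mod_cast hj
            omega
          rw [this]; ring
      -- palindromicity of P''
      have hpal'' : ∀ j ≤ 2 * d, P''.coeff j = P''.coeff (2 * d - j) := by
        intro j hj
        rw [hP''coeff, hP''coeff, hcq, hcq, if_neg (by omega), if_neg (by omega), if_neg (by omega),
          if_neg (by omega)]
        have := hpal (j + 1) (by omega)
        rw [show 2 * (d + 1) - (j + 1) = 2 * d - j + 1 by omega] at this
        rw [this]
      obtain ⟨Q'', hQ''deg, hQ''coeff, hQ''eval⟩ := trace_poly_exists d P'' hdeg'' hpal''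
      refine ⟨C c * dickson 1 (1 : K) (d + 1) + Q'', ?_, ?_, ?_⟩
      · refine natDegree_add_le_of_degree_le (le_trans (natDegree_C_mul_le c _) ?_) (le_trans hQ''deg (by omega))
        exact dickson_one_one_natDegree_le (d + 1)
      · rw [coeff_add, coeff_C_mul, dickson_one_one_coeff_self d, mul_one,
          coeff_eq_zero_of_natDegree_lt (lt_of_le_of_lt hQ''deg (by omega)), add_zero]
      · intro x hx
        have hPq : P = P'' * X + C (q.coeff 0) + C c * (X ^ (2 * (d + 1)) + 1) := by
          rw [hP'', divX_mul_X_add, hq]; ring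
        have hq0 : q.coeff 0 = 0 := by
          rw [hcq, if_neg (by omega), if_pos rfl, hc0]; ring
        have hD := dickson_one_one_eval_add_inv x x⁻¹ (mul_inv_cancel₀ hx) (d + 1)
        rw [hPq, hq0, map_zero, add_zero]
        simp only [eval_add, eval_mul, eval_X, eval_C, eval_pow, eval_one, hD, hQ''eval x hx]
        have hxinv : x ^ (d + 1) * x⁻¹ ^ (d + 1) = 1 := by
          rw [← mul_pow, mul_inv_cancel₀ hx, one_pow]
        calc x ^ d * eval (x + x⁻¹) Q'' * x + c * (x ^ (2 * (d + 1)) + 1)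
            = x ^ (d + 1) * eval (x + x⁻¹) Q'' + c * (x ^ (d + 1) * x ^ (d + 1) +
                x ^ (d + 1) * x⁻¹ ^ (d + 1)) := by rw [hxinv]; ring
          _ = x ^ (d + 1) * (c * (x ^ (d + 1) + x⁻¹ ^ (d + 1)) + eval (x + x⁻¹) Q'') := by ring

/-! ## Factorisation over `ℂ` -/

end Literature.NumberTheory.MahlerMeasure

end Part1

/-!
## Part 2 — port of `Summits/Ventures/DiscreteObjects/Mahler/ReciprocalFamilies.lean` (4 declarations kept)

# The three enumerated families: palindromic (`rec`), antipalindromic (`anti`), odd degree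

Cell `pub-namedobj`, seat `pub-namedobj-mahler-g2`, target (L). Framing: lottery ticket; floor = certified
bounds/negative ranges.

Root-free structure lemmas over `ℤ[x]` for the families enumerated by the census engines
(`HOME/code/censusL/polyz.py: build_full`):

* `reverse_eq_self_of_palindromic` / `palindromic_of_reverse_eq_self`: `a_j = a_{N-j}` iff `reverse P = P`
  (for `natDegree P = N`); `reverse_eq_neg_of_antipalindromic` for `a_j = -a_{N-j}`;
* `eval_neg_one_eq_zero_of_palindromic_odd`: an odd-degree palindromic `P` has `P(-1) = 0`;
  `eval_one_eq_zero_of_antipalindromic`, `eval_neg_one_eq_zero_of_antipalindromic_even`;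
* `odd_palindromic_decomposition`: monic palindromic `P` of degree `2d+1` is `(x+1)·R` with `R` monic palindromic
  of degree `2d`;
* `antipalindromic_decomposition`: monic antipalindromic `P` of degree `2d ≥ 2` is `(x²-1)·R` with `R` monic
  palindromic of degree `2d-2`.

These reduce the `anti` and odd-`n` families to the `rec` family treated in `ReciprocalFactorisation.lean`.
-/

section Part2

namespace Literature.NumberTheory.MahlerMeasure

open _root_.Polynomial

/-- Palindromic coefficients ⇒ `reverse P = P`.
[cite: MckeeSmyth2021, §A.1 (palindromic = self-reciprocal; values at −1)] -/
theorem reverse_eq_self_of_palindromic {R : Type*} [CommRing R] (P : R[X]) (N : ℕ) (hdeg : P.natDegree = N)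
    (hpal : ∀ j ≤ N, P.coeff j = P.coeff (N - j)) : P.reverse = P := by
  ext j
  by_cases hj : j ≤ N
  · rw [coeff_reverse, hdeg, revAt_le hj, ← hpal j hj]
  · rw [not_le] at hj
    rw [coeff_eq_zero_of_natDegree_lt (lt_of_le_of_lt (reverse_natDegree_le P) (by rw [hdeg]; exact hj)),
      coeff_eq_zero_of_natDegree_lt (by rw [hdeg]; exact hj)]

/-- `reverse R = R` ⇒ palindromic coefficients.
[cite: MckeeSmyth2021, §A.1 (palindromic = self-reciprocal; values at −1)] -/
theorem palindromic_of_reverse_eq_self {R : Type*} [CommRing R] (P : R[X]) (N : ℕ) (hdeg : P.natDegree = N)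
    (hrev : P.reverse = P) : ∀ j ≤ N, P.coeff j = P.coeff (N - j) := by
  intro j hj
  conv_lhs => rw [← hrev]
  rw [coeff_reverse, hdeg, revAt_le hj]

/-- Evaluation identity for self-reverse / anti-self-reverse polynomials at `±1`.
[cite: MckeeSmyth2021, §A.1 (palindromic = self-reciprocal; values at −1)] -/
theorem eval_eq_eval_reverse_mul {R : Type*} [CommRing R] (P : R[X]) (x : R) (hx : x * x = 1) :
    P.eval x = P.reverse.eval x * x ^ P.natDegree := by
  haveI : Invertible x := ⟨x, hx, hx⟩
  have h := eval₂_reverse_mul_pow (RingHom.id R) x P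
  rw [eval₂_id, eval₂_id] at h
  have hinv : (⅟x : R) = x := by
    rw [← mul_one (⅟x), ← hx, ← mul_assoc, invOf_mul_self, one_mul]
  rw [hinv] at h
  exact h.symm

/-- An odd-degree palindromic integer polynomial vanishes at `-1`.
[cite: MckeeSmyth2021, §A.1 (palindromic = self-reciprocal; values at −1)] -/
theorem eval_neg_one_eq_zero_of_palindromic_odd (P : ℤ[X]) (d : ℕ) (hdeg : P.natDegree = 2 * d + 1)
    (hpal : ∀ j ≤ 2 * d + 1, P.coeff j = P.coeff (2 * d + 1 - j)) : P.eval (-1) = 0 := by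
  have h := eval_eq_eval_reverse_mul P (-1) (by norm_num)
  rw [reverse_eq_self_of_palindromic P _ hdeg hpal, hdeg, pow_succ, pow_mul] at h
  norm_num at h
  linarith

end Literature.NumberTheory.MahlerMeasure

end Part2

/-!
## Part 3 — port of `Summits/Ventures/DiscreteObjects/Mahler/LehmerTraceIrreducible.lean` (5 declarations kept)

# The trace polynomial of Lehmer's polynomial is irreducible (venture `DiscreteObjects`, target L)

Cell `pub-namedobj`, seat `pub-namedobj-mahler` (gen 9). Framing: lottery ticket; floor = certified
bounds/negative ranges.

Lehmer's polynomial `L = x¹⁰+x⁹-x⁷-x⁶-x⁵-x⁴-x³+x+1` is `x⁵·Q(x + 1/x)` with the trace polynomial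
`Q(y) = y⁵ + y⁴ - 5y³ - 5y² + 4y + 3` (`LehmerExactMeasure.lehmer_eval_eq_trace`).  Here: `Q` is
irreducible over `ℤ`, because its reduction `y⁵ + y⁴ + y³ + y² + 1` modulo `2` is irreducible over `𝔽₂`
(no root in `𝔽₂`, and not divisible by the unique irreducible quadratic `y² + y + 1`, since
`y⁵+y⁴+y³+y²+1 = (y²+y+1)(y³+1) + y`).  Used in `LehmerIrreducible` to prove that `L` itself is irreducible.

* `irreducible_lehmerTrace_mod_two` — irreducibility over `ZMod 2`;
* `irreducible_lehmerTrace` — **`y⁵ + y⁴ - 5y³ - 5y² + 4y + 3` is irreducible over `ℤ`**.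
-/

section Part3

namespace Literature.NumberTheory.MahlerMeasure

open _root_.Polynomial

/-- `2 = 0` in `𝔽₂[X]`.
[cite: Lehmer1933, Ann. of Math. 34 (the polynomial L); see MckeeSmyth2021 glossary p.38 (Lehmer's polynomial) — irreducibility of its trace polynomial y⁵+y⁴−5y³−5y²+4y+3 via reduction mod 2] -/
theorem two_eq_zero_zmod_two_poly : (2 : (ZMod 2)[X]) = 0 := by
  have h := CharP.cast_eq_zero (R := (ZMod 2)[X]) 2
  simpa using h

/-- The reduction of the trace polynomial modulo `2`.
[cite: Lehmer1933, Ann. of Math. 34 (the polynomial L); see MckeeSmyth2021 glossary p.38 (Lehmer's polynomial) — irreducibility of its trace polynomial y⁵+y⁴−5y³−5y²+4y+3 via reduction mod 2] -/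
theorem lehmerTrace_map_mod_two :
    (X ^ 5 + X ^ 4 - 5 * X ^ 3 - 5 * X ^ 2 + 4 * X + 3 : ℤ[X]).map (Int.castRingHom (ZMod 2)) =
      X ^ 5 + X ^ 4 + X ^ 3 + X ^ 2 + 1 := by
  have e : (X ^ 5 + X ^ 4 - 5 * X ^ 3 - 5 * X ^ 2 + 4 * X + 3 : ℤ[X]) =
      X ^ 5 + X ^ 4 - C 5 * X ^ 3 - C 5 * X ^ 2 + C 4 * X + C 3 := by
    simp only [map_ofNat]
  have h5 : ((5 : ℤ) : ZMod 2) = 1 := by decide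
  have h4 : ((4 : ℤ) : ZMod 2) = 0 := by decide
  have h3 : ((3 : ℤ) : ZMod 2) = 1 := by decide
  rw [e]
  simp only [Polynomial.map_add, Polynomial.map_sub, Polynomial.map_mul, Polynomial.map_pow, map_X,
    Polynomial.map_C]
  simp only [eq_intCast, h5, h4, h3, map_one, map_zero, zero_mul, add_zero]
  linear_combination (-(X ^ 3 + X ^ 2 : (ZMod 2)[X])) * two_eq_zero_zmod_two_poly

/-- `q = y⁵ + y⁴ + y³ + y² + 1` has no root in `𝔽₂`.
[cite: Lehmer1933, Ann. of Math. 34 (the polynomial L); see MckeeSmyth2021 glossary p.38 (Lehmer's polynomial) — irreducibility of its trace polynomial y⁵+y⁴−5y³−5y²+4y+3 via reduction mod 2] -/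
theorem lehmerTrace_mod_two_eval_ne_zero (r : ZMod 2) :
    (X ^ 5 + X ^ 4 + X ^ 3 + X ^ 2 + 1 : (ZMod 2)[X]).eval r ≠ 0 := by
  simp only [eval_add, eval_pow, eval_X, eval_one]
  have h01 : ∀ c : ZMod 2, c = 0 ∨ c = 1 := by decide
  rcases h01 r with h | h <;> rw [h] <;> decide

/-- **`y⁵ + y⁴ + y³ + y² + 1` is irreducible over `𝔽₂`.**
[cite: Lehmer1933, Ann. of Math. 34 (the polynomial L); see MckeeSmyth2021 glossary p.38 (Lehmer's polynomial) — irreducibility of its trace polynomial y⁵+y⁴−5y³−5y²+4y+3 via reduction mod 2] -/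
theorem irreducible_lehmerTrace_mod_two :
    Irreducible (X ^ 5 + X ^ 4 + X ^ 3 + X ^ 2 + 1 : (ZMod 2)[X]) := by
  set q : (ZMod 2)[X] := X ^ 5 + X ^ 4 + X ^ 3 + X ^ 2 + 1 with hq
  have hqdeg : q.natDegree = 5 := by rw [hq]; compute_degree!
  have hqm : q.Monic := by rw [hq]; monicity!
  have hq1 : q ≠ 1 := by
    intro h
    have := congrArg natDegree h
    rw [hqdeg, natDegree_one] at this
    exact absurd this (by norm_num)
  have h01 : ∀ c : ZMod 2, c = 0 ∨ c = 1 := by decide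
  rw [hqm.irreducible_iff_lt_natDegree_lt hq1]
  intro d hdm hdeg hdvd
  rw [hqdeg, Finset.mem_Ioc] at hdeg
  -- a root of `d` would be a root of `q`
  have hnoroot : ∀ r : ZMod 2, d.eval r ≠ 0 := by
    intro r hr
    obtain ⟨e, he⟩ := hdvd
    have : q.eval r = 0 := by rw [he, eval_mul, hr, zero_mul]
    exact lehmerTrace_mod_two_eval_ne_zero r (by rw [← hq]; exact this)
  rcases (show d.natDegree = 1 ∨ d.natDegree = 2 by omega) with h1 | h2
  · -- degree 1: `d = X + c` has the root `c` (`= -c` in characteristic 2)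
    have hd := hdm.eq_X_add_C h1
    rcases h01 (d.coeff 0) with hc | hc
    · exact hnoroot 0 (by rw [hd, hc]; simp)
    · exact hnoroot 1 (by rw [hd, hc, eval_add, eval_X, eval_C]; decide)
  · -- degree 2: `d = X² + c₁ X + c₀`
    have hd : d = X ^ 2 + C (d.coeff 1) * X + C (d.coeff 0) := by
      conv_lhs => rw [hdm.as_sum, h2]
      simp only [Finset.sum_range_succ, Finset.sum_range_zero, zero_add, pow_zero, mul_one, pow_one]
      ring
    rcases h01 (d.coeff 0) with hc0 | hc0 <;> rcases h01 (d.coeff 1) with hc1 | hc1 <;>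
      rw [hc0, hc1] at hd
    · -- `X²`: root `0`
      exact hnoroot 0 (by rw [hd]; simp)
    · -- `X² + X`: root `0`
      exact hnoroot 0 (by rw [hd]; simp)
    · -- `X² + 1`: root `1`
      refine hnoroot 1 ?_
      rw [hd, map_zero, zero_mul, add_zero, map_one, eval_add, eval_pow, eval_X, eval_one]
      decide
    · -- `X² + X + 1`: `q = (X²+X+1)(X³+1) + X`, so `X² + X + 1 ∣ X`, impossible
      rw [map_one, one_mul] at hd
      rw [hd] at hdvd
      have hrem : q = (X ^ 2 + X + 1) * (X ^ 3 + 1) + X := by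
        rw [hq]
        linear_combination (-(X : (ZMod 2)[X])) * two_eq_zero_zmod_two_poly
      have hX : (X ^ 2 + X + 1 : (ZMod 2)[X]) ∣ X := by
        have h := dvd_sub hdvd (dvd_mul_right (X ^ 2 + X + 1 : (ZMod 2)[X]) (X ^ 3 + 1))
        have e : q - (X ^ 2 + X + 1) * (X ^ 3 + 1) = X := by rw [hrem]; ring
        rwa [e] at h
      have hdeg2 : (X ^ 2 + X + 1 : (ZMod 2)[X]).natDegree = 2 := by compute_degree!
      have := natDegree_le_of_dvd hX X_ne_zero
      rw [hdeg2, natDegree_X] at this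
      omega

/-- **The trace polynomial `y⁵ + y⁴ - 5y³ - 5y² + 4y + 3` of Lehmer's polynomial is irreducible over `ℤ`.**
[cite: Lehmer1933, Ann. of Math. 34 (the polynomial L); see MckeeSmyth2021 glossary p.38 (Lehmer's polynomial) — irreducibility of its trace polynomial y⁵+y⁴−5y³−5y²+4y+3 via reduction mod 2] -/
theorem irreducible_lehmerTrace :
    Irreducible (X ^ 5 + X ^ 4 - 5 * X ^ 3 - 5 * X ^ 2 + 4 * X + 3 : ℤ[X]) := by
  refine Monic.irreducible_of_irreducible_map (Int.castRingHom (ZMod 2)) _ (by monicity!) ?_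
  rw [lehmerTrace_map_mod_two]
  exact irreducible_lehmerTrace_mod_two

end Literature.NumberTheory.MahlerMeasure

end Part3

/-!
## Part 4 — port of `Summits/Ventures/DiscreteObjects/Mahler/LehmerIrreducible.lean` (5 declarations kept)

# Lehmer's polynomial is irreducible (venture `DiscreteObjects`, target L)

Cell `pub-namedobj`, seat `pub-namedobj-mahler` (gen 9). Framing: lottery ticket; floor = certified
bounds/negative ranges.

`L = x¹⁰ + x⁹ - x⁷ - x⁶ - x⁵ - x⁴ - x³ + x + 1` (Lehmer 1933) is irreducible over `ℤ`, so Lehmer's number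
`M(L) = 1.17628…` is an algebraic integer of degree `10` (a Salem number) with minimal polynomial `L`.
Proof (kernel): let `L = A·B` with `A, B` monic.  Since `M(A) ≤ M(L) < 1.1763 < θ₀`, Smyth's theorem
(`intMahlerMeasure_ge_smythTheta_of_nonreciprocal`) forces `A` and `B` to be (anti)reciprocal; as
`L(1) = -1 ≠ 0` and `L(-1) = 1 ≠ 0` they are reciprocal of even degrees `2a`, `2b`.  Writing
`A = x^a Q_A(x + 1/x)`, `B = x^b Q_B(x + 1/x)` (`trace_poly_exists`) and `L = x⁵ Q(x + 1/x)` gives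
`Q = Q_A Q_B` over `ℚ` (equality at infinitely many points `n + 1/n`), and `Q = y⁵+y⁴-5y³-5y²+4y+3` is
irreducible (`irreducible_lehmerTrace`, via `𝔽₂`), so `a = 0` or `b = 0`.

* `lehmerPoly_monic_factor_trivial` — a monic factorisation `L = A·B` has a constant factor;
* `irreducible_lehmerPoly` — **Lehmer's polynomial is irreducible over `ℤ`**.
-/

section Part4

namespace Literature.NumberTheory.MahlerMeasure

open _root_.Polynomial

/-- Basic facts: `deg L = 10`, `L(0) = 1`, `L(1) = -1`, `L(-1) = 1`.
[cite: Lehmer1933, Ann. of Math. 34; see MckeeSmyth2021 glossary p.38 and §1.1 p.22 (Lehmer's polynomial L(z) = z¹⁰+z⁹−z⁷−z⁶−z⁵−z⁴−z³+z+1 is irreducible)] -/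
theorem lehmerPoly_facts :
    lehmerPolynomial.natDegree = 10 ∧ lehmerPolynomial.coeff 0 = 1 ∧ lehmerPolynomial.eval 1 = -1 ∧ lehmerPolynomial.eval (-1) = 1 := by
  unfold lehmerPolynomial
  refine ⟨by compute_degree!, ?_, ?_, ?_⟩
  · simp [coeff_one, coeff_X]
  · simp
  · simp

/-- A monic factor of Lehmer's polynomial is reciprocal (`A.reverse = A`): by Smyth's theorem a
nonreciprocal factor would have measure `≥ θ₀ > M(L)`, and an antireciprocal one would vanish at `1`.
[cite: Lehmer1933, Ann. of Math. 34; see MckeeSmyth2021 glossary p.38 and §1.1 p.22 (Lehmer's polynomial L(z) = z¹⁰+z⁹−z⁷−z⁶−z⁵−z⁴−z³+z+1 is irreducible)] -/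
theorem reverse_eq_of_monic_dvd_lehmerPoly {A B : ℤ[X]} (hA : A.Monic) (hB : B.Monic)
    (h : lehmerPolynomial = A * B) : A.reverse = A := by
  obtain ⟨_, hL0, hL1, _⟩ := lehmerPoly_facts
  have hA0 : A.coeff 0 ≠ 0 := by
    intro h0
    have := congrArg (fun p : ℤ[X] => p.coeff 0) h
    simp only [mul_coeff_zero, h0, zero_mul, hL0] at this
    exact one_ne_zero this
  -- `M(A) ≤ M(L) < θ₀`
  have hMA : intMahlerMeasure A < smythTheta := by
    have hprod : intMahlerMeasure lehmerPolynomial = intMahlerMeasure A * intMahlerMeasure B := by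
      rw [h, intMahlerMeasure_mul]
    have hB1 := one_le_intMahlerMeasure hB.ne_zero
    have hA1 := one_le_intMahlerMeasure hA.ne_zero
    have hL := lehmer_measure_upper_bound
    have hθ := smythTheta_gt
    nlinarith
  -- so `A` is reciprocal or antireciprocal
  have hrec : A.reverse = A ∨ A.reverse = -A := by
    by_contra hne
    push Not at hne
    have := intMahlerMeasure_ge_smythTheta_of_nonreciprocal hA0 hne.1 hne.2
    linarith
  rcases hrec with hr | hr
  · exact hr
  · -- antireciprocal: `A(1) = 0`, contradicting `L(1) = -1`
    exfalso
    have h1 := eval_eq_eval_reverse_mul A 1 (by norm_num)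
    rw [hr, eval_neg, one_pow, mul_one] at h1
    have hA1 : A.eval 1 = 0 := by linarith
    have : lehmerPolynomial.eval 1 = 0 := by rw [h, eval_mul, hA1, zero_mul]
    rw [hL1] at this
    norm_num at this

/-- A monic factor of Lehmer's polynomial has even degree (an odd-degree reciprocal polynomial vanishes
at `-1`, but `L(-1) = 1`).
[cite: Lehmer1933, Ann. of Math. 34; see MckeeSmyth2021 glossary p.38 and §1.1 p.22 (Lehmer's polynomial L(z) = z¹⁰+z⁹−z⁷−z⁶−z⁵−z⁴−z³+z+1 is irreducible)] -/
theorem even_natDegree_of_monic_dvd_lehmerPoly {A B : ℤ[X]} (hA : A.Monic) (hB : B.Monic)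
    (h : lehmerPolynomial = A * B) : Even A.natDegree := by
  obtain ⟨_, _, _, hLm1⟩ := lehmerPoly_facts
  have hrev := reverse_eq_of_monic_dvd_lehmerPoly hA hB h
  by_contra hodd
  rw [Nat.not_even_iff_odd] at hodd
  obtain ⟨d, hd⟩ := hodd
  have hpal := palindromic_of_reverse_eq_self A _ hd hrev
  have hA1 := eval_neg_one_eq_zero_of_palindromic_odd A d hd hpal
  have : lehmerPolynomial.eval (-1) = 0 := by rw [h, eval_mul, hA1, zero_mul]
  rw [hLm1] at this
  exact one_ne_zero this

/-- **A monic factorisation `L = A·B` of Lehmer's polynomial is trivial.**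
[cite: Lehmer1933, Ann. of Math. 34; see MckeeSmyth2021 glossary p.38 and §1.1 p.22 (Lehmer's polynomial L(z) = z¹⁰+z⁹−z⁷−z⁶−z⁵−z⁴−z³+z+1 is irreducible)] -/
theorem lehmerPoly_monic_factor_trivial {A B : ℤ[X]} (hA : A.Monic) (hB : B.Monic)
    (h : lehmerPolynomial = A * B) : A.natDegree = 0 ∨ B.natDegree = 0 := by
  obtain ⟨hLdeg, _, _, _⟩ := lehmerPoly_facts
  have hrevA := reverse_eq_of_monic_dvd_lehmerPoly hA hB h
  have hrevB := reverse_eq_of_monic_dvd_lehmerPoly hB hA (by rw [h, mul_comm])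
  obtain ⟨a, ha⟩ := even_natDegree_of_monic_dvd_lehmerPoly hA hB h
  obtain ⟨b, hb⟩ := even_natDegree_of_monic_dvd_lehmerPoly hB hA (by rw [h, mul_comm])
  rw [← two_mul] at ha hb
  have hab : a + b = 5 := by
    have := congrArg natDegree h
    rw [hA.natDegree_mul hB, hLdeg, ha, hb] at this
    omega
  -- trace polynomials over `ℚ`
  set AQ := A.map (algebraMap ℤ ℚ) with hAQ
  set BQ := B.map (algebraMap ℤ ℚ) with hBQ
  have hinj : Function.Injective (algebraMap ℤ ℚ) := (algebraMap ℤ ℚ).injective_int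
  have hpalA : ∀ j ≤ 2 * a, AQ.coeff j = AQ.coeff (2 * a - j) := by
    intro j hj
    rw [hAQ, coeff_map, coeff_map, palindromic_of_reverse_eq_self A _ ha hrevA j hj]
  have hpalB : ∀ j ≤ 2 * b, BQ.coeff j = BQ.coeff (2 * b - j) := by
    intro j hj
    rw [hBQ, coeff_map, coeff_map, palindromic_of_reverse_eq_self B _ hb hrevB j hj]
  obtain ⟨QA, hQAdeg, hQAlc, hQAev⟩ := trace_poly_exists a AQ
    (by rw [hAQ, natDegree_map_eq_of_injective hinj, ha]) hpalA
  obtain ⟨QB, hQBdeg, hQBlc, hQBev⟩ := trace_poly_exists b BQ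
    (by rw [hBQ, natDegree_map_eq_of_injective hinj, hb]) hpalB
  have hQAlc1 : QA.coeff a = 1 := by
    rw [hQAlc, hAQ, coeff_map, ← ha, hA.coeff_natDegree, map_one]
  have hQBlc1 : QB.coeff b = 1 := by
    rw [hQBlc, hBQ, coeff_map, ← hb, hB.coeff_natDegree, map_one]
  -- the trace polynomial of `L` over `ℚ` equals `QA * QB`
  set Q : ℤ[X] := X ^ 5 + X ^ 4 - 5 * X ^ 3 - 5 * X ^ 2 + 4 * X + 3 with hQ
  have hQev : ∀ x : ℚ, x ≠ 0 →
      (Q.map (algebraMap ℤ ℚ)).eval (x + x⁻¹) = (QA * QB).eval (x + x⁻¹) := by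
    intro x hx
    have hL : (lehmerPolynomial.map (algebraMap ℤ ℚ)).eval x = x ^ 5 * (Q.map (algebraMap ℤ ℚ)).eval (x + x⁻¹) := by
      have e := lehmer_eval_eq_trace x hx
      unfold lehmerPolynomial
      rw [hQ]
      simp only [Polynomial.map_add, Polynomial.map_sub, Polynomial.map_mul, Polynomial.map_pow, map_X,
        Polynomial.map_one, Polynomial.map_ofNat, eval_add, eval_sub, eval_mul, eval_pow, eval_X, eval_one,
        eval_ofNat]
      rw [e]
    have hL' : (lehmerPolynomial.map (algebraMap ℤ ℚ)).eval x = x ^ 5 * (QA * QB).eval (x + x⁻¹) := by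
      rw [h, Polynomial.map_mul, eval_mul, ← hAQ, ← hBQ, hQAev x hx, hQBev x hx, eval_mul, ← hab, pow_add]
      ring
    have hx5 : x ^ 5 ≠ 0 := pow_ne_zero _ hx
    exact mul_left_cancel₀ hx5 (hL.symm.trans hL')
  have hQeq : Q.map (algebraMap ℤ ℚ) = QA * QB := by
    apply eq_of_infinite_eval_eq
    -- the points `n + 1/n`, `n ≥ 2`, are distinct
    refine Set.infinite_of_injective_forall_mem (f := fun n : ℕ => ((n : ℚ) + 2) + ((n : ℚ) + 2)⁻¹) ?_ ?_
    · intro m n hmn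
      simp only at hmn
      have hm : (0 : ℚ) < (m : ℚ) + 2 := by positivity
      have hn : (0 : ℚ) < (n : ℚ) + 2 := by positivity
      have key : (((m : ℚ) + 2) - ((n : ℚ) + 2)) * (((m : ℚ) + 2) * ((n : ℚ) + 2) - 1) = 0 := by
        field_simp at hmn
        linear_combination hmn
      rcases mul_eq_zero.mp key with h1 | h1
      · exact_mod_cast (by linarith : (m : ℚ) = n)
      · exfalso
        have : (4 : ℚ) ≤ ((m : ℚ) + 2) * ((n : ℚ) + 2) := by nlinarith
        linarith
    · intro n
      exact hQev _ (by positivity)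
  -- `Q` is irreducible over `ℚ`, hence `QA` or `QB` is a unit
  have hQm : Q.Monic := by rw [hQ]; monicity!
  have hQirrQ : Irreducible (Q.map (algebraMap ℤ ℚ)) :=
    (hQm.irreducible_iff_irreducible_map_fraction_map (K := ℚ)).mp (by rw [hQ]; exact irreducible_lehmerTrace)
  rw [hQeq] at hQirrQ
  rcases hQirrQ.isUnit_or_isUnit rfl with hu | hu
  · left
    have h0 := natDegree_eq_zero_of_isUnit hu
    have : a ≤ QA.natDegree := le_natDegree_of_ne_zero (by rw [hQAlc1]; exact one_ne_zero)
    omega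
  · right
    have h0 := natDegree_eq_zero_of_isUnit hu
    have : b ≤ QB.natDegree := le_natDegree_of_ne_zero (by rw [hQBlc1]; exact one_ne_zero)
    omega

/-- **Lehmer's polynomial `x¹⁰ + x⁹ - x⁷ - x⁶ - x⁵ - x⁴ - x³ + x + 1` is irreducible over `ℤ`**; hence
Lehmer's number `M(L) = 1.17628…` is an algebraic integer of degree `10`.
[cite: Lehmer1933, Ann. of Math. 34; see MckeeSmyth2021 glossary p.38 and §1.1 p.22 (Lehmer's polynomial L(z) = z¹⁰+z⁹−z⁷−z⁶−z⁵−z⁴−z³+z+1 is irreducible)] -/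
theorem irreducible_lehmerPoly : Irreducible lehmerPolynomial := by
  obtain ⟨hLdeg, _, _, _⟩ := lehmerPoly_facts
  refine irreducible_iff.mpr ⟨fun hu => ?_, fun A B hAB => ?_⟩
  · have := natDegree_eq_zero_of_isUnit hu
    omega
  -- leading coefficients `±1`; normalise to monic factors
  have hlc : A.leadingCoeff * B.leadingCoeff = 1 := by
    rw [← leadingCoeff_mul, ← hAB]; exact lehmerPoly_monic.leadingCoeff
  set u := A.leadingCoeff with hu
  set v := B.leadingCoeff with hv
  have hu1 : u * u = 1 := by rcases Int.eq_one_or_neg_one_of_mul_eq_one hlc with h | h <;> rw [h] <;> norm_num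
  have hv1 : v * v = 1 := by
    rcases Int.eq_one_or_neg_one_of_mul_eq_one (by rw [mul_comm]; exact hlc) with h | h <;> rw [h] <;> norm_num
  have hA0 : A ≠ 0 := by intro h0; rw [h0, leadingCoeff_zero] at hu; rw [hu, zero_mul] at hu1; exact zero_ne_one hu1
  have hB0 : B ≠ 0 := by intro h0; rw [h0, leadingCoeff_zero] at hv; rw [hv, zero_mul] at hv1; exact zero_ne_one hv1
  have hAm : (C u * A).Monic := by
    rw [Monic, leadingCoeff_mul, leadingCoeff_C, ← hu, hu1]
  have hBm : (C v * B).Monic := by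
    rw [Monic, leadingCoeff_mul, leadingCoeff_C, ← hv, hv1]
  have hfac : lehmerPolynomial = (C u * A) * (C v * B) := by
    rw [hAB]
    have : C u * C v = (1 : ℤ[X]) := by rw [← map_mul, hlc, map_one]
    linear_combination (-(A * B)) * this
  have hu0 : u ≠ 0 := by intro h0; rw [h0, zero_mul] at hu1; exact zero_ne_one hu1
  have hv0 : v ≠ 0 := by intro h0; rw [h0, zero_mul] at hv1; exact zero_ne_one hv1
  rcases lehmerPoly_monic_factor_trivial hAm hBm hfac with h | h
  · left
    rw [natDegree_C_mul hu0] at h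
    rw [eq_C_of_natDegree_eq_zero h, isUnit_C]
    have : A.coeff 0 = u := by
      rw [hu, leadingCoeff, h]
    rw [this]
    exact isUnit_iff_exists_inv.mpr ⟨u, hu1⟩
  · right
    rw [natDegree_C_mul hv0] at h
    rw [eq_C_of_natDegree_eq_zero h, isUnit_C]
    have : B.coeff 0 = v := by
      rw [hv, leadingCoeff, h]
    rw [this]
    exact isUnit_iff_exists_inv.mpr ⟨v, hv1⟩

end Literature.NumberTheory.MahlerMeasure

end Part4

/-!
## Part 5 — port of `Summits/Ventures/DiscreteObjects/Mahler/LehmerSalem.lean` (4 declarations kept)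

# Lehmer's number is a Salem number of degree 10 (venture `DiscreteObjects`, target L)

Cell `pub-namedobj`, seat `pub-namedobj-mahler` (gen 9). Framing: lottery ticket; floor = certified
bounds/negative ranges.

The root structure of Lehmer's polynomial `L = x¹⁰+x⁹-x⁷-x⁶-x⁵-x⁴-x³+x+1`, extracted from the method of
`LehmerExactMeasure` (g2): over `ℂ`, `L = ∏ᵢ (x² - yᵢ x + 1)` over the five real roots
`y₁ < y₂ < y₃ < y₄ < 2 < y₅` of the trace polynomial `Q(y) = y⁵+y⁴-5y³-5y²+4y+3`; the four factors with
`|yᵢ| < 2` have their roots on the unit circle, the last one has the real roots `τ = (y₅ + √(y₅²-4))/2 > 1`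
and `τ⁻¹`.  Hence every complex root of `L` is `τ`, `τ⁻¹`, or of modulus `1`, and `M(L) = τ`
(`lehmer_salem`).  Together with `irreducible_lehmerPoly` (p268683) and `deg L = 10`: **Lehmer's number
`τ = M(L) = 1.17628…` is a Salem number of degree `10` with minimal polynomial `L`.**

* `norm_eq_one_of_quad_root`, `eq_or_eq_inv_of_quad_root` — roots of `x² - yx + 1` for real `y`;
* `lehmerPoly_map_eq_prod` — the factorisation over `ℂ` with the root brackets;
* `lehmer_salem` — **the Salem structure of the roots of `L`**.
-/

section Part5

namespace Literature.NumberTheory.MahlerMeasure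

open _root_.Polynomial
open scoped ComplexConjugate

/-- For real `-2 < y < 2`, every root of `x² - yx + 1` has modulus `1`.
[cite: Lehmer1933, Ann. of Math. 34; see MckeeSmyth2021 §5.2 p.83 (Salem polynomials / Salem numbers) with §1.1 p.22 (M(L) = 1.17628…): Lehmer's number is a Salem number] -/
theorem norm_eq_one_of_quad_root {y : ℝ} (h1 : -2 < y) (h2 : y < 2) {α : ℂ}
    (h : α ^ 2 - (y : ℂ) * α + 1 = 0) : ‖α‖ = 1 := by
  have hpos : 0 ≤ 4 - y ^ 2 := by nlinarith
  set s : ℝ := Real.sqrt (4 - y ^ 2) with hs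
  have hs2 : s ^ 2 = 4 - y ^ 2 := by rw [hs]; exact Real.sq_sqrt hpos
  set z₁ : ℂ := ((y : ℂ) + (s : ℂ) * Complex.I) / 2 with hz₁
  set z₂ : ℂ := ((y : ℂ) - (s : ℂ) * Complex.I) / 2 with hz₂
  have hs2c : (s : ℂ) ^ 2 = 4 - (y : ℂ) ^ 2 := by exact_mod_cast hs2
  have hsum : z₁ + z₂ = (y : ℂ) := by rw [hz₁, hz₂]; ring
  have hprod : z₁ * z₂ = 1 := by
    rw [hz₁, hz₂]
    have hI : Complex.I ^ 2 = -1 := Complex.I_sq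
    linear_combination (1 / 4 : ℂ) * hs2c - ((s : ℂ) ^ 2 / 4) * hI
  have hconj : conj z₁ = z₂ := by
    rw [hz₁, hz₂]
    simp [map_div₀, Complex.conj_ofReal, map_ofNat, sub_eq_add_neg]
  have hn1 : ‖z₁‖ = 1 := by
    have hm := Complex.mul_conj z₁
    rw [hconj, hprod] at hm
    have hsq : Complex.normSq z₁ = 1 := by exact_mod_cast hm.symm
    have : ‖z₁‖ ^ 2 = 1 := by rw [← Complex.normSq_eq_norm_sq]; exact hsq
    nlinarith [norm_nonneg z₁]
  have hn2 : ‖z₂‖ = 1 := by rw [← hconj, Complex.norm_conj]; exact hn1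
  have hfac : (α - z₁) * (α - z₂) = 0 := by
    have e : (α - z₁) * (α - z₂) = α ^ 2 - (z₁ + z₂) * α + z₁ * z₂ := by ring
    rw [e, hsum, hprod, h]
  rcases mul_eq_zero.mp hfac with hα | hα
  · rw [sub_eq_zero.mp hα]; exact hn1
  · rw [sub_eq_zero.mp hα]; exact hn2

/-- For real `y > 2`, the roots of `x² - yx + 1` are `τ = (y + √(y²-4))/2` and `τ⁻¹`.
[cite: Lehmer1933, Ann. of Math. 34; see MckeeSmyth2021 §5.2 p.83 (Salem polynomials / Salem numbers) with §1.1 p.22 (M(L) = 1.17628…): Lehmer's number is a Salem number] -/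
theorem eq_or_eq_inv_of_quad_root {y : ℝ} (hy : 2 < y) {α : ℂ} (h : α ^ 2 - (y : ℂ) * α + 1 = 0) :
    α = (((y + Real.sqrt (y ^ 2 - 4)) / 2 : ℝ) : ℂ) ∨ α = ((((y + Real.sqrt (y ^ 2 - 4)) / 2)⁻¹ : ℝ) : ℂ) := by
  have hpos : 0 ≤ y ^ 2 - 4 := by nlinarith
  set t : ℝ := Real.sqrt (y ^ 2 - 4) with ht
  have ht2 : t ^ 2 = y ^ 2 - 4 := by rw [ht]; exact Real.sq_sqrt hpos
  set r₁ : ℝ := (y + t) / 2 with hr₁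
  set r₂ : ℝ := (y - t) / 2 with hr₂
  have hsum : r₁ + r₂ = y := by rw [hr₁, hr₂]; ring
  have hprod : r₁ * r₂ = 1 := by rw [hr₁, hr₂]; nlinarith
  have hinv : r₁⁻¹ = r₂ := inv_eq_of_mul_eq_one_right hprod
  have hfac : (α - r₁) * (α - r₂) = 0 := by
    have e : (α - r₁) * (α - r₂) = α ^ 2 - ((r₁ : ℂ) + r₂) * α + (r₁ : ℂ) * r₂ := by ring
    have h1 : (r₁ : ℂ) + r₂ = (y : ℂ) := by exact_mod_cast hsum
    have h2 : (r₁ : ℂ) * r₂ = 1 := by exact_mod_cast hprod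
    rw [e, h1, h2, h]
  rw [hinv]
  rcases mul_eq_zero.mp hfac with hα | hα
  · exact Or.inl (sub_eq_zero.mp hα)
  · exact Or.inr (sub_eq_zero.mp hα)

/-- **`L = ∏ᵢ (x² - yᵢ x + 1)` over `ℂ`**, over the five real roots of the trace polynomial, with their
rational brackets (the method of `LehmerExactMeasure`, re-run with the factorisation exported).
[cite: Lehmer1933, Ann. of Math. 34; see MckeeSmyth2021 §5.2 p.83 (Salem polynomials / Salem numbers) with §1.1 p.22 (M(L) = 1.17628…): Lehmer's number is a Salem number] -/
theorem lehmerPoly_map_eq_prod : ∃ y₁ y₂ y₃ y₄ y₅ : ℝ,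
    (-2 < y₁ ∧ y₁ < 2) ∧ (-2 < y₂ ∧ y₂ < 2) ∧ (-2 < y₃ ∧ y₃ < 2) ∧ (-2 < y₄ ∧ y₄ < 2) ∧
    ((1176280818259 / 10 ^ 12 : ℝ) + (1176280818259 / 10 ^ 12)⁻¹ < y₅ ∧
      y₅ < (1176280818260 / 10 ^ 12 : ℝ) + (1176280818260 / 10 ^ 12)⁻¹) ∧
    lehmerPolynomial.map (Int.castRingHom ℂ) =
      (({(y₁ : ℂ), (y₂ : ℂ), (y₃ : ℂ), (y₄ : ℂ), (y₅ : ℂ)} : Multiset ℂ).map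
        fun w => (X ^ 2 - C w * X + 1 : ℂ[X])).prod := by
  obtain ⟨y₁, y₂, y₃, y₄, y₅, h1, h2, h3, h4, h5, hroots⟩ := lehmer_trace_roots
  have hc_lo : (2 : ℝ) < (1176280818259 / 10 ^ 12 : ℝ) + (1176280818259 / 10 ^ 12)⁻¹ := by norm_num
  have hy5 : 2 < y₅ := lt_trans hc_lo h5.1
  refine ⟨y₁, y₂, y₃, y₄, y₅, ⟨h1.1, by linarith [h1.2]⟩, ⟨by linarith [h2.1], by linarith [h2.2]⟩,
    ⟨by linarith [h3.1], by linarith [h3.2]⟩, ⟨by linarith [h4.1], by linarith [h4.2]⟩, h5, ?_⟩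
  have hrootsC : ∀ y ∈ [y₁, y₂, y₃, y₄, y₅],
      (y : ℂ) ^ 5 + (y : ℂ) ^ 4 - 5 * (y : ℂ) ^ 3 - 5 * (y : ℂ) ^ 2 + 4 * (y : ℂ) + 3 = 0 := by
    intro y hy
    exact_mod_cast hroots y hy
  set s : Multiset ℂ := {(y₁ : ℂ), (y₂ : ℂ), (y₃ : ℂ), (y₄ : ℂ), (y₅ : ℂ)} with hs
  have h12 : (y₁ : ℂ) ≠ y₂ := by exact_mod_cast ne_of_lt (by linarith [h1.2, h2.1] : y₁ < y₂)
  have h13 : (y₁ : ℂ) ≠ y₃ := by exact_mod_cast ne_of_lt (by linarith [h1.2, h3.1] : y₁ < y₃)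
  have h14 : (y₁ : ℂ) ≠ y₄ := by exact_mod_cast ne_of_lt (by linarith [h1.2, h4.1] : y₁ < y₄)
  have h15 : (y₁ : ℂ) ≠ y₅ := by exact_mod_cast ne_of_lt (by linarith [h1.2, hy5] : y₁ < y₅)
  have h23 : (y₂ : ℂ) ≠ y₃ := by exact_mod_cast ne_of_lt (by linarith [h2.2, h3.1] : y₂ < y₃)
  have h24 : (y₂ : ℂ) ≠ y₄ := by exact_mod_cast ne_of_lt (by linarith [h2.2, h4.1] : y₂ < y₄)
  have h25 : (y₂ : ℂ) ≠ y₅ := by exact_mod_cast ne_of_lt (by linarith [h2.2, hy5] : y₂ < y₅)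
  have h34 : (y₃ : ℂ) ≠ y₄ := by exact_mod_cast ne_of_lt (by linarith [h3.2, h4.1] : y₃ < y₄)
  have h35 : (y₃ : ℂ) ≠ y₅ := by exact_mod_cast ne_of_lt (by linarith [h3.2, hy5] : y₃ < y₅)
  have h45 : (y₄ : ℂ) ≠ y₅ := by exact_mod_cast ne_of_lt (by linarith [h4.2, hy5] : y₄ < y₅)
  have hs_card : Multiset.card s = 5 := by rw [hs]; simp
  have hs_nodup : s.Nodup := by
    rw [hs]
    simp [Multiset.insert_eq_cons, h12, h13, h14, h15, h23, h24, h25, h34, h35, h45]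
  have hQeval : ∀ t : ℂ, (X ^ 5 + X ^ 4 - 5 * X ^ 3 - 5 * X ^ 2 + 4 * X + 3 : ℂ[X]).eval t =
      t ^ 5 + t ^ 4 - 5 * t ^ 3 - 5 * t ^ 2 + 4 * t + 3 := by
    intro t; simp
  have hQmonic : (X ^ 5 + X ^ 4 - 5 * X ^ 3 - 5 * X ^ 2 + 4 * X + 3 : ℂ[X]).Monic := by monicity!
  have hQdeg : (X ^ 5 + X ^ 4 - 5 * X ^ 3 - 5 * X ^ 2 + 4 * X + 3 : ℂ[X]).natDegree = 5 := by
    compute_degree!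
  have hQne : (X ^ 5 + X ^ 4 - 5 * X ^ 3 - 5 * X ^ 2 + 4 * X + 3 : ℂ[X]) ≠ 0 := hQmonic.ne_zero
  have hs_sub : s ⊆ (X ^ 5 + X ^ 4 - 5 * X ^ 3 - 5 * X ^ 2 + 4 * X + 3 : ℂ[X]).roots := by
    intro w hw
    rw [mem_roots hQne, IsRoot.def, hQeval]
    rw [hs] at hw
    simp only [Multiset.insert_eq_cons, Multiset.mem_cons, Multiset.mem_singleton] at hw
    rcases hw with rfl | rfl | rfl | rfl | rfl
    · exact hrootsC y₁ (by simp)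
    · exact hrootsC y₂ (by simp)
    · exact hrootsC y₃ (by simp)
    · exact hrootsC y₄ (by simp)
    · exact hrootsC y₅ (by simp)
  have hs_le : s ≤ (X ^ 5 + X ^ 4 - 5 * X ^ 3 - 5 * X ^ 2 + 4 * X + 3 : ℂ[X]).roots :=
    (Multiset.le_iff_subset hs_nodup).mpr hs_sub
  have hroots_eq : (X ^ 5 + X ^ 4 - 5 * X ^ 3 - 5 * X ^ 2 + 4 * X + 3 : ℂ[X]).roots = s := by
    symm
    apply Multiset.eq_of_le_of_card_le hs_le
    rw [hs_card]
    exact (card_roots' _).trans_eq hQdeg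
  have hQsplit : (X ^ 5 + X ^ 4 - 5 * X ^ 3 - 5 * X ^ 2 + 4 * X + 3 : ℂ[X]) =
      (s.map fun w => X - C w).prod := by
    rw [← hroots_eq]
    exact (IsAlgClosed.splits _).eq_prod_roots_of_monic hQmonic
  have hQprod : ∀ t : ℂ, t ^ 5 + t ^ 4 - 5 * t ^ 3 - 5 * t ^ 2 + 4 * t + 3 =
      (t - y₁) * (t - y₂) * (t - y₃) * (t - y₄) * (t - y₅) := by
    intro t
    have h' := congrArg (Polynomial.eval t) hQsplit
    rw [hQeval, eval_multiset_prod, hs] at h'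
    simp only [Multiset.insert_eq_cons, Multiset.map_cons, Multiset.map_singleton, Multiset.prod_cons,
      Multiset.prod_singleton, eval_sub, eval_X, eval_C] at h'
    linear_combination h'
  have hLeval : ∀ x : ℂ, (lehmerPolynomial.map (Int.castRingHom ℂ)).eval x =
      x ^ 10 + x ^ 9 - x ^ 7 - x ^ 6 - x ^ 5 - x ^ 4 - x ^ 3 + x + 1 := by
    intro x
    rw [eval_map, ← algebraMap_int_eq, ← aeval_def, aeval_lehmerPoly]
  apply Polynomial.funext
  intro x
  rw [hLeval, eval_multiset_prod, hs]
  simp only [Multiset.insert_eq_cons, Multiset.map_cons, Multiset.map_singleton, Multiset.prod_cons,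
    Multiset.prod_singleton, eval_add, eval_sub, eval_mul, eval_pow, eval_X, eval_C, eval_one]
  rcases eq_or_ne x 0 with rfl | hx
  · norm_num
  · rw [lehmer_eval_eq_trace x hx, hQprod (x + x⁻¹)]
    field_simp
    ring

/-- **Lehmer's number is a Salem number.**  There is a real `τ > 1` with `M(L) = τ`, such that `τ` and
`τ⁻¹` are roots of Lehmer's polynomial `L` and every complex root of `L` is `τ`, `τ⁻¹` or of modulus `1`.
(With `irreducible_lehmerPoly` and `deg L = 10`: `τ = 1.17628…` is a Salem number of degree `10` whose
minimal polynomial is `L`.)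
[cite: Lehmer1933, Ann. of Math. 34; see MckeeSmyth2021 §5.2 p.83 (Salem polynomials / Salem numbers) with §1.1 p.22 (M(L) = 1.17628…): Lehmer's number is a Salem number] -/
theorem lehmer_salem : ∃ τ : ℝ, 1 < τ ∧ intMahlerMeasure lehmerPolynomial = τ ∧
    (τ : ℂ) ∈ (lehmerPolynomial.map (Int.castRingHom ℂ)).roots ∧
    ((τ⁻¹ : ℝ) : ℂ) ∈ (lehmerPolynomial.map (Int.castRingHom ℂ)).roots ∧
    ∀ α ∈ (lehmerPolynomial.map (Int.castRingHom ℂ)).roots, α = τ ∨ α = ((τ⁻¹ : ℝ) : ℂ) ∨ ‖α‖ = 1 := by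
  obtain ⟨y₁, y₂, y₃, y₄, y₅, h1, h2, h3, h4, h5, hLP⟩ := lehmerPoly_map_eq_prod
  have hc_lo : (2 : ℝ) < (1176280818259 / 10 ^ 12 : ℝ) + (1176280818259 / 10 ^ 12)⁻¹ := by norm_num
  have hy5 : 2 < y₅ := lt_trans hc_lo h5.1
  set τ : ℝ := (y₅ + Real.sqrt (y₅ ^ 2 - 4)) / 2 with hτ
  have ht0 : 0 ≤ Real.sqrt (y₅ ^ 2 - 4) := Real.sqrt_nonneg _
  have hτ1 : 1 < τ := by rw [hτ]; linarith
  have hL0 : lehmerPolynomial.map (Int.castRingHom ℂ) ≠ 0 := (lehmerPoly_monic.map _).ne_zero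
  -- the quadratic factor `x² - y₅ x + 1` has the roots `τ`, `τ⁻¹`
  have hpos : 0 ≤ y₅ ^ 2 - 4 := by nlinarith
  have ht2 : Real.sqrt (y₅ ^ 2 - 4) ^ 2 = y₅ ^ 2 - 4 := Real.sq_sqrt hpos
  have hτroot : (τ : ℂ) ^ 2 - (y₅ : ℂ) * τ + 1 = 0 := by
    have : τ ^ 2 - y₅ * τ + 1 = 0 := by rw [hτ]; nlinarith
    exact_mod_cast this
  have hτprod : τ * ((y₅ - Real.sqrt (y₅ ^ 2 - 4)) / 2) = 1 := by rw [hτ]; nlinarith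
  have hτinv : τ⁻¹ = (y₅ - Real.sqrt (y₅ ^ 2 - 4)) / 2 := inv_eq_of_mul_eq_one_right hτprod
  have hτinvroot : ((τ⁻¹ : ℝ) : ℂ) ^ 2 - (y₅ : ℂ) * ((τ⁻¹ : ℝ) : ℂ) + 1 = 0 := by
    have : (τ⁻¹) ^ 2 - y₅ * τ⁻¹ + 1 = 0 := by rw [hτinv]; nlinarith
    exact_mod_cast this
  -- evaluation of `L` as the product of the five quadratics
  have hLev : ∀ α : ℂ, (lehmerPolynomial.map (Int.castRingHom ℂ)).eval α =
      (α ^ 2 - y₁ * α + 1) * ((α ^ 2 - y₂ * α + 1) * ((α ^ 2 - y₃ * α + 1) *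
        ((α ^ 2 - y₄ * α + 1) * (α ^ 2 - y₅ * α + 1)))) := by
    intro α
    rw [hLP, eval_multiset_prod]
    simp only [Multiset.insert_eq_cons, Multiset.map_cons, Multiset.map_singleton, Multiset.prod_cons,
      Multiset.prod_singleton, eval_add, eval_sub, eval_mul, eval_pow, eval_X, eval_C, eval_one]
  have hmem : ∀ α : ℂ, α ^ 2 - (y₅ : ℂ) * α + 1 = 0 → α ∈ (lehmerPolynomial.map (Int.castRingHom ℂ)).roots := by
    intro α hα
    rw [mem_roots hL0, IsRoot.def, hLev, hα]
    ring
  refine ⟨τ, hτ1, ?_, hmem _ hτroot, hmem _ hτinvroot, ?_⟩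
  · -- `M(L) = τ`
    unfold intMahlerMeasure
    rw [hLP, prod_mahlerMeasure_eq_mahlerMeasure_prod, Multiset.map_map]
    simp only [Multiset.insert_eq_cons, Multiset.map_cons, Multiset.map_singleton, Multiset.prod_cons,
      Multiset.prod_singleton, Function.comp_apply]
    rw [mahlerMeasure_quad_of_abs_lt_two h1.1 h1.2, mahlerMeasure_quad_of_abs_lt_two h2.1 h2.2,
      mahlerMeasure_quad_of_abs_lt_two h3.1 h3.2, mahlerMeasure_quad_of_abs_lt_two h4.1 h4.2,
      mahlerMeasure_quad_of_two_lt hy5, hτ]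
    ring
  · intro α hα
    rw [mem_roots hL0, IsRoot.def, hLev] at hα
    rcases mul_eq_zero.mp hα with h | hα
    · exact Or.inr (Or.inr (norm_eq_one_of_quad_root h1.1 h1.2 h))
    rcases mul_eq_zero.mp hα with h | hα
    · exact Or.inr (Or.inr (norm_eq_one_of_quad_root h2.1 h2.2 h))
    rcases mul_eq_zero.mp hα with h | hα
    · exact Or.inr (Or.inr (norm_eq_one_of_quad_root h3.1 h3.2 h))
    rcases mul_eq_zero.mp hα with h | h
    · exact Or.inr (Or.inr (norm_eq_one_of_quad_root h4.1 h4.2 h))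
    · rcases eq_or_eq_inv_of_quad_root hy5 h with h' | h'
      · exact Or.inl (by rw [h', hτ])
      · exact Or.inr (Or.inl (by rw [h', hτ]))

end Literature.NumberTheory.MahlerMeasure

end Part5

/-!
## Part 6 — port of `Summits/Ventures/DiscreteObjects/Mahler/LehmerNumber.lean` (1 declarations kept)

# Lehmer's number, in one statement (venture `DiscreteObjects`, target L)

Cell `pub-namedobj`, seat `pub-namedobj-mahler` (gen 9). Framing: lottery ticket; floor = certified
bounds/negative ranges.

The object of target (L) — Lehmer's number `λ₁₀ = M(L) = 1.176280818259…`, the conjecturally smallest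
Mahler measure `> 1` (Lehmer 1933) — assembled from the kernel files `LehmerExactMeasure` (g2: `M(L)` to
12 digits), `LehmerIrreducible` (g9: `L` irreducible) and `LehmerSalem` (g9: root structure):

* `lehmer_number` — there is a real `τ` with `1.176280818259 < τ < 1.176280818260`, `M(L) = τ`,
  `L` irreducible of degree `10`, `τ` and `τ⁻¹` roots of `L`, and all other complex roots of `L` on the
  unit circle — i.e. **Lehmer's number is a Salem number of degree 10 with minimal polynomial
  `L = x¹⁰+x⁹-x⁷-x⁶-x⁵-x⁴-x³+x+1`**.
-/

section Part6

namespace Literature.NumberTheory.MahlerMeasure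

open _root_.Polynomial

/-- **Lehmer's number.**  `L = x¹⁰+x⁹-x⁷-x⁶-x⁵-x⁴-x³+x+1` is irreducible of degree `10`, and its Mahler
measure `τ = M(L) ∈ (1.176280818259, 1.176280818260)` is a root of `L` together with `τ⁻¹`, all other
complex roots of `L` lying on the unit circle (a Salem number of degree `10`).
[cite: Lehmer1933, Ann. of Math. 34; see MckeeSmyth2021 §1.1 p.22 and glossary p.38 (Lehmer's number M(L) = 1.17628…, a Salem number of degree 10)] -/
theorem lehmer_number : Irreducible lehmerPolynomial ∧ lehmerPolynomial.natDegree = 10 ∧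
    ∃ τ : ℝ, (1176280818259 / 10 ^ 12 : ℝ) < τ ∧ τ < 1176280818260 / 10 ^ 12 ∧
      intMahlerMeasure lehmerPolynomial = τ ∧
      (τ : ℂ) ∈ (lehmerPolynomial.map (Int.castRingHom ℂ)).roots ∧
      ((τ⁻¹ : ℝ) : ℂ) ∈ (lehmerPolynomial.map (Int.castRingHom ℂ)).roots ∧
      ∀ α ∈ (lehmerPolynomial.map (Int.castRingHom ℂ)).roots, α = τ ∨ α = ((τ⁻¹ : ℝ) : ℂ) ∨ ‖α‖ = 1 := by
  obtain ⟨τ, _, hM, hτ, hτinv, hroots⟩ := lehmer_salem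
  obtain ⟨hlo, hhi⟩ := lehmer_measure_enclosure
  rw [hM] at hlo hhi
  exact ⟨irreducible_lehmerPoly, lehmerPoly_facts.1, τ, hlo, hhi, hM, hτ, hτinv, hroots⟩

end Literature.NumberTheory.MahlerMeasure

end Part6

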